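import Summits.QuantumFields.YangMills.Theorems.FluctuationComparisonRegPrIntLS2BetaCornerOfRecord
import Summits.QuantumFields.YangMills.Theorems.FluctuationComparisonRegPrIntLS2BetaJacPiSinc
import HarnessLib

/-!
# S2β · DET-REP (B) — THE TUBE OF RECORD, FRAMED: `exists_tubeRows_pos` with the free-bond FRAME `eV`, the bondwise formula of the transversal,
# the density formula, and POSITIVITY OF `jV` ON THE WHOLE TRANSVERSAL WINDOW

Cell `ym3-torus` (rung R3: continuum `SU(2)` Yang–Mills on `T³` — NOT `d = 4`, NOT infinite volume, NOT a mass gap, NOT Clay); seat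
`ymfull-r3-prover-4` g0 (R590-ym (a) item (4), DET-REP (B)); definition-free helper of the crux `stmt-QuantumFields-20520`
(`--supports … --as helper`, NOT a proof of it and NOT a proof of any registered stub).  Registry of record:
`Cruxes/FluctuationComparisonRegPrIntL/Lines/semiclassical_s2beta.lean` v11.4, `def DetRepB` :1072–1098, `def TubeRows` :957–988.

WHY.  The tube third of `DetRepB` is supplied by text by ✓`…S2BetaTubeOfRecord.exists_tubeRows` (p755703) ∕ ✓`…S2BetaCornerOfRecord.exists_tubeRows_pos`
(px21 g11's E3″ chart ✓`…TubularChartDockLocal.exists_tubularHaarChart_pivotAct_local` through ANY fine field `U₀`, transversal window SHRUNK to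
`‖(eV y)_b‖ < ½`).  Both DROP three things the DET-REP (B) organ hands need: (i) the FRAME `eV : ℝ^{dV} ≃L 𝔰𝔲(2)^{free bonds}` with (D0) `σ y = U₀` on comb ∪ pivots,
(D1) constant comb transporter, (F4a) the BONDWISE formula `σ y b = U₀ b · (T(b₊)⁻¹ · exp((eV y)_b) · T(b₊))` (the DETN hand's step-adapted flag and the
plaquette-locality of `A ∘ σ` live in these coordinates — px21 g17 LOCATE-DETREPB B2), (F4b′) `jV = σ₀·|det jac(eV ·)|`; (ii) the WINDOW BOUND
`∀ y ∈ UV, ‖(eV y)_b‖ < ½`; (iii) POSITIVITY OF `jV` ON THE WHOLE WINDOW (`exists_tubeRows_pos` has it only at and near `0`) — the `0 < jV y` conjunct of the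
non-base corner letter (Q-TUBE) of ✓`…S2BetaCornerInTube.cornerRows_text_of_pivotAct_eq` (p784096).  THIS FILE re-runs `exists_tubeRows_pos` (same
construction, same proof) KEEPING those rows:
* ★★ `exists_tubeRows_framed` — `∃ e σ eV UZ UV jZ jV ρ, σ 0 = U₀ ∧ 0 ∈ UV ∧ 0 < jV 0 ∧ (∀ᶠ y, 0 < jV y) ∧ (∀ y ∈ UV, ∀ b, ‖(eV y)_b‖ < ½) ∧
  (∀ y ∈ UV, 0 < jV y) ∧ (D0) ∧ (D1) ∧ (F4a) ∧ (F4b′) ∧ ⟨the line's `TubeRows` body, nineteen conjuncts, TOKEN FOR TOKEN⟩`.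
  Positivity: (F4b′) + ✓`…S2BetaJacPiSinc.det_jac_pi_su2_pos` (`det jac_{𝔰𝔲(2)^B}(X) > 0` once every `‖X_b‖ < π`; here `< ½`).
So on the tube of record the letter (Q-TUBE) at a corner `X` reads simply `∃ k, ∃ y ∈ UV, pivotAct (iterCentralBond (K−J)) k (σ y) = U_X`.

HONEST SCOPE.  A re-export over landed letters (zero new mathematics); def-free; default heartbeats; proves nothing of (Q-TUBE)∕DETN∕JACW∕DET-REP (B)∕GAP♯∕S2β∕
the crux 20520; finite-volume∕conditional programme; `YM3TorusSU2` NOT proved; rung R3 = SU(2) YM₃ on T³ — NOT d = 4, NOT infinite volume, NOT a mass gap, NOT Clay;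
the Yang–Mills mass gap is NOT proved.

References: [Helgason2000] Ch. I §1 Thm 1.14 p. 96; [Balaban1985Variational] CMP 102 (1985) Thm 1 (8)–(10) p. 279, (19) p. 281, (142) p. 299;
[Balaban1985Averaging] CMP 98 (1985) (8), (10) p. 18; [Balaban1985UV3] CMP 102 (1985) (18) p. 260.
-/

noncomputable section

open MeasureTheory MeasureTheory.Measure Filter Topology Set Function Metric
open scoped ENNReal Matrix.Norms.L2Operator ContDiff
open Literature.MathematicalPhysics.QuantumFieldTheory.Balaban1983to89
open Literature.MathematicalPhysics.QuantumFieldTheory.Balaban1983to89.T3ContinuumYM3Torus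
open Literature.MathematicalPhysics.QuantumFieldTheory.Balaban1983to89.HaarExponentialChart
open Literature.MathematicalPhysics.QuantumFieldTheory.Balaban1983to89.LogChartProduct
open Literature.MathematicalPhysics.QuantumFieldTheory.Balaban1983to89.T3UnitLawDensityEML
open Literature.MathematicalPhysics.QuantumFieldTheory.Balaban1983to89.T3TiltDescent
open Literature.MathematicalPhysics.QuantumFieldTheory.Balaban1983to89.T3ConstrainedMinimiser (fibre)
open Literature.MathematicalPhysics.QuantumFieldTheory.Balaban1983to89.T4Continuum
open Literature.MathematicalPhysics.QuantumFieldTheory.Balaban1983to89.B13HaarSigmaJacobian (jac)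
open scoped Literature.MathematicalPhysics.QuantumFieldTheory.Balaban1983to89.T3OrbitAverage
open Summit.QuantumFields.YangMills.Theorems.FluctuationComparisonRegPrIntLWregChain (iterCentralBond)
open Summit.QuantumFields.YangMills.Theorems.FluctuationComparisonRegPrIntLWregGlue (WindowChart)
open Summit.QuantumFields.YangMills.Theorems.FluctuationComparisonRegPrIntLS2BetaResidualSubgroup
open Summit.QuantumFields.YangMills.Theorems.FluctuationComparisonRegPrIntLS2BetaTubularChartDockLocal
open Summit.QuantumFields.YangMills.Theorems.FluctuationComparisonRegPrIntLS2BetaTransversalShiftUniform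
open Summit.QuantumFields.YangMills.Theorems.FluctuationComparisonRegPrIntLS2BetaSignedComb (combTransporter)
open Summit.QuantumFields.YangMills.Theorems.FluctuationComparisonRegPrIntLS2BetaSignedCombKill (combSet)

namespace Summit.QuantumFields.YangMills.Theorems.FluctuationComparisonRegPrIntLS2BetaTubeOfRecordFramed

variable (F : T3Family) {J K : ℕ} (hJK : J ≤ K)

/-- ★★ **THE TUBE OF RECORD, FRAMED** — ✓`…S2BetaCornerOfRecord.exists_tubeRows_pos` (E3″ through `U₀`, window shrunk to `‖(eV y)_b‖ < ½`, (T2-ALL) by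
✓`offPivot_transversal_shift_uniform`, the Haar chart identity restricted to the smaller window) re-run KEEPING: the frame `eV`, the window bound
`∀ y ∈ UV, ∀ b, ‖(eV y)_b‖ < ½`, POSITIVITY `∀ y ∈ UV, 0 < jV y` ((F4b′) + ✓`det_jac_pi_su2_pos`), (D0) `σ y = U₀` on comb ∪ pivots, (D1) the constant comb
transporter, (F4a) the bondwise formula of `σ`, (F4b′) the density formula; then the nineteen `TubeRows` conjuncts of LINE g18-1 by text.
[cite: Helgason2000, Ch. I §1 Thm 1.14 p.96; Balaban1985Variational, Thm 1 (8)-(10) p.279 and (19) p.281; Balaban1985Averaging, (8), (10) p.18] -/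
theorem exists_tubeRows_framed (hk : K - J ≤ (F.P K).m + (F.P K).K)
    [DecidablePred (· ∈ (combSet (K - J) : Set (PBond (F.P K) 0)) ∪ Set.range (iterCentralBond (P := F.P K) (K - J)))] (dZ dV : ℕ)
    (hdZ : dZ = Module.finrank ℝ (specialUnitaryLogChart (Fin 2)).lie *
      ((Fintype.card (Site (F.P K) 0) - Fintype.card (Site (F.P K) (K - J))) + Fintype.card (PBond (F.P K) (K - J))))
    (hdV : dV = Module.finrank ℝ (specialUnitaryLogChart (Fin 2)).lie *
        (Fintype.card (PBond (F.P K) 0) - Fintype.card (PBond (F.P K) (K - J))) -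
      Module.finrank ℝ (specialUnitaryLogChart (Fin 2)).lie * (Fintype.card (Site (F.P K) 0) - Fintype.card (Site (F.P K) (K - J))))
    (U₀ : GaugeField (F.P K) 0 (Matrix.specialUnitaryGroup (Fin 2) ℂ)) :
    ∃ (e : EuclideanSpace ℝ (Fin dZ) → ↥(residualSubgroup F hJK) × (PBond (F.P K) (K - J) → Matrix.specialUnitaryGroup (Fin 2) ℂ))
      (σ : EuclideanSpace ℝ (Fin dV) → GaugeField (F.P K) 0 (Matrix.specialUnitaryGroup (Fin 2) ℂ))
      (eV : EuclideanSpace ℝ (Fin dV) ≃L[ℝ] (piLogChart (specialUnitaryLogChart (Fin 2)) {b : PBond (F.P K) 0 // b ∉ (combSet (K - J) : Set (PBond (F.P K) 0)) ∪ Set.range (iterCentralBond (P := F.P K) (K - J))}).lie)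
      (UZ : Set (EuclideanSpace ℝ (Fin dZ))) (UV : Set (EuclideanSpace ℝ (Fin dV)))
      (jZ : EuclideanSpace ℝ (Fin dZ) → ℝ) (jV : EuclideanSpace ℝ (Fin dV) → ℝ) (ρ : ℝ),
      σ 0 = U₀ ∧ (0 : EuclideanSpace ℝ (Fin dV)) ∈ UV ∧ 0 < jV 0 ∧ (∀ᶠ y in 𝓝 (0 : EuclideanSpace ℝ (Fin dV)), 0 < jV y) ∧
      (∀ y ∈ UV, ∀ b : {b : PBond (F.P K) 0 // b ∉ (combSet (K - J) : Set (PBond (F.P K) 0)) ∪ Set.range (iterCentralBond (P := F.P K) (K - J))}, ‖((eV y : (piLogChart (specialUnitaryLogChart (Fin 2)) {b : PBond (F.P K) 0 // b ∉ (combSet (K - J) : Set (PBond (F.P K) 0)) ∪ Set.range (iterCentralBond (P := F.P K) (K - J))}).lie) : {b : PBond (F.P K) 0 // b ∉ (combSet (K - J) : Set (PBond (F.P K) 0)) ∪ Set.range (iterCentralBond (P := F.P K) (K - J))} → Matrix (Fin 2) (Fin 2) ℂ) b‖ < 1 / 2) ∧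
      (∀ y ∈ UV, 0 < jV y) ∧
      (∀ y, ∀ b ∈ (combSet (K - J) : Set (PBond (F.P K) 0)) ∪ Set.range (iterCentralBond (P := F.P K) (K - J)), σ y b = U₀ b) ∧
      (∀ y, combTransporter (K - J) (σ y) = combTransporter (K - J) U₀) ∧
      (∀ y (b : PBond (F.P K) 0) (hb : b ∉ (combSet (K - J) : Set (PBond (F.P K) 0)) ∪ Set.range (iterCentralBond (P := F.P K) (K - J))),
        σ y b = U₀ b * ((combTransporter (K - J) U₀ b.tgt)⁻¹ *
          (isChartRep_specialUnitaryGroup (n := Fin 2)).expChart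
            (lieApply (specialUnitaryLogChart (Fin 2)) {b : PBond (F.P K) 0 // b ∉ (combSet (K - J) : Set (PBond (F.P K) 0)) ∪ Set.range (iterCentralBond (P := F.P K) (K - J))} (eV y) ⟨b, hb⟩) *
          combTransporter (K - J) U₀ b.tgt)) ∧
      (∃ σ₀ : ℝ, 0 < σ₀ ∧ ∀ y, jV y = σ₀ * |LinearMap.det
        (jac (lie_adStable_pi (specialUnitaryLogChart (Fin 2)) {b : PBond (F.P K) 0 // b ∉ (combSet (K - J) : Set (PBond (F.P K) 0)) ∪ Set.range (iterCentralBond (P := F.P K) (K - J))}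
            (lie_adStable_specialUnitaryGroup (n := Fin 2))) (eV y) :
          (piLogChart (specialUnitaryLogChart (Fin 2)) {b : PBond (F.P K) 0 // b ∉ (combSet (K - J) : Set (PBond (F.P K) 0)) ∪ Set.range (iterCentralBond (P := F.P K) (K - J))}).lie →ₗ[ℝ]
          (piLogChart (specialUnitaryLogChart (Fin 2)) {b : PBond (F.P K) 0 // b ∉ (combSet (K - J) : Set (PBond (F.P K) 0)) ∪ Set.range (iterCentralBond (P := F.P K) (K - J))}).lie)|) ∧
      (Continuous e ∧ e 0 = 1 ∧
      𝓝 (1 : ↥(residualSubgroup F hJK) × (PBond (F.P K) (K - J) → Matrix.specialUnitaryGroup (Fin 2) ℂ)) ≤ map e (𝓝 0) ∧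
      Continuous σ ∧
      ContDiff ℝ ⊤ (fun y : EuclideanSpace ℝ (Fin dV) => fun b : PBond (F.P K) 0 => ((σ y b : Matrix.specialUnitaryGroup (Fin 2) ℂ) : Matrix (Fin 2) (Fin 2) ℂ)) ∧
      IsOpen UZ ∧ IsOpen UV ∧ (0 : EuclideanSpace ℝ (Fin dZ)) ∈ UZ ∧
      (∀ y₁ ∈ UV, ∃ c : ℝ, 0 < c ∧ ∀ᶠ v in 𝓝 (0 : EuclideanSpace ℝ (Fin dV)),
        c * ‖v‖ ^ 2 ≤ ⨅ w : {w : Site (F.P K) 0 → Matrix.specialUnitaryGroup (Fin 2) ℂ |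
              ∀ U : GaugeField (F.P K) 0 (Matrix.specialUnitaryGroup (Fin 2) ℂ),
                descendTo F ℰp J K hJK (GaugeField.gaugeAct w U) = descendTo F ℰp J K hJK U},
            ∑ ℓ ∈ Finset.univ.filter (fun ℓ : PBond (F.P K) 0 =>
                ∀ c', iterCentralBond (P := F.P K) (K - J) c' ≠ ℓ),
              dist1 (σ (y₁ + v) ℓ * ((GaugeField.gaugeAct (w : Site (F.P K) 0 → Matrix.specialUnitaryGroup (Fin 2) ℂ) (σ y₁)) ℓ)⁻¹) ^ 2) ∧
      InjOn (fun p : EuclideanSpace ℝ (Fin dZ) × EuclideanSpace ℝ (Fin dV) =>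
        pivotAct F hJK (iterCentralBond (P := F.P K) (K - J)) (e p.1) (σ p.2)) (UZ ×ˢ UV) ∧
      (∀ p ∈ UZ ×ˢ UV, ∀ s ∈ 𝓝 p, (fun p : EuclideanSpace ℝ (Fin dZ) × EuclideanSpace ℝ (Fin dV) =>
        pivotAct F hJK (iterCentralBond (P := F.P K) (K - J)) (e p.1) (σ p.2)) '' s ∈
        𝓝 ((fun p : EuclideanSpace ℝ (Fin dZ) × EuclideanSpace ℝ (Fin dV) =>
        pivotAct F hJK (iterCentralBond (P := F.P K) (K - J)) (e p.1) (σ p.2)) p)) ∧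
      ContinuousOn jZ UZ ∧ ContinuousOn jV UV ∧ (∀ z ∈ UZ, 0 ≤ jZ z) ∧ (∀ y ∈ UV, 0 ≤ jV y) ∧
      (fieldMeasure (F.P K) 0 (Matrix.specialUnitaryGroup (Fin 2) ℂ)).restrict
          ((fun p : EuclideanSpace ℝ (Fin dZ) × EuclideanSpace ℝ (Fin dV) =>
            pivotAct F hJK (iterCentralBond (P := F.P K) (K - J)) (e p.1) (σ p.2)) '' (UZ ×ˢ UV)) =
        ((((volume : Measure (EuclideanSpace ℝ (Fin dZ))).prod (volume : Measure (EuclideanSpace ℝ (Fin dV)))).restrict (UZ ×ˢ UV)).withDensity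
            fun w => ENNReal.ofReal (jZ w.1 * jV w.2)).map
          (fun p : EuclideanSpace ℝ (Fin dZ) × EuclideanSpace ℝ (Fin dV) =>
            pivotAct F hJK (iterCentralBond (P := F.P K) (K - J)) (e p.1) (σ p.2)) ∧
      0 < ρ ∧ Metric.closedBall (0 : EuclideanSpace ℝ (Fin dZ)) ρ ⊆ UZ ∧ 0 < ∫ z in Metric.ball (0 : EuclideanSpace ℝ (Fin dZ)) ρ, jZ z) := by
  obtain ⟨e, σ, eV, UZ, UV, jZ, jV, ρ, he, he1, he𝓝, hσ, hσ0, hσs, hD0, hD1, hF4a, -, -, hUZo, hUVo, h0Z, h0V, hinj, hF3,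
      hjZc, hjVc, hjZ0, hjV0, -, hjVpos, hjVev, hF4b, hchart, hρ, hρUZ, hjZint⟩ :=
    exists_tubularHaarChart_pivotAct_local F hJK hk dZ dV hdZ hdV U₀
  -- the uniform off-pivot transversality of the tube on the small window
  obtain ⟨c₁, hc₁, hT2u⟩ := offPivot_transversal_shift_uniform F hJK hk eV hD0 hD1 hF4a
  -- the shrunk transversal window `UV ∩ S`, `S := ‖(eV y)_b‖ < 1/2` for every free bond
  have hSo : IsOpen {y : EuclideanSpace ℝ (Fin dV) | ∀ b : {b : PBond (F.P K) 0 // b ∉ (combSet (K - J) : Set (PBond (F.P K) 0)) ∪ Set.range (iterCentralBond (P := F.P K) (K - J))}, ‖((eV y : (piLogChart (specialUnitaryLogChart (Fin 2)) {b : PBond (F.P K) 0 // b ∉ (combSet (K - J) : Set (PBond (F.P K) 0)) ∪ Set.range (iterCentralBond (P := F.P K) (K - J))}).lie) : {b : PBond (F.P K) 0 // b ∉ (combSet (K - J) : Set (PBond (F.P K) 0)) ∪ Set.range (iterCentralBond (P := F.P K) (K - J))} → Matrix (Fin 2) (Fin 2) ℂ) b‖ < 1 / 2} := by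
    rw [Set.setOf_forall]
    refine isOpen_iInter_of_finite fun b => ?_
    have hcont : Continuous fun y : EuclideanSpace ℝ (Fin dV) =>
        ‖((eV y : (piLogChart (specialUnitaryLogChart (Fin 2)) {b : PBond (F.P K) 0 // b ∉ (combSet (K - J) : Set (PBond (F.P K) 0)) ∪ Set.range (iterCentralBond (P := F.P K) (K - J))}).lie) : {b : PBond (F.P K) 0 // b ∉ (combSet (K - J) : Set (PBond (F.P K) 0)) ∪ Set.range (iterCentralBond (P := F.P K) (K - J))} → Matrix (Fin 2) (Fin 2) ℂ) b‖ :=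
      ((continuous_apply b).comp (continuous_subtype_val.comp eV.continuous)).norm
    exact isOpen_lt hcont continuous_const
  have h0S : (0 : EuclideanSpace ℝ (Fin dV)) ∈ {y : EuclideanSpace ℝ (Fin dV) | ∀ b : {b : PBond (F.P K) 0 // b ∉ (combSet (K - J) : Set (PBond (F.P K) 0)) ∪ Set.range (iterCentralBond (P := F.P K) (K - J))}, ‖((eV y : (piLogChart (specialUnitaryLogChart (Fin 2)) {b : PBond (F.P K) 0 // b ∉ (combSet (K - J) : Set (PBond (F.P K) 0)) ∪ Set.range (iterCentralBond (P := F.P K) (K - J))}).lie) : {b : PBond (F.P K) 0 // b ∉ (combSet (K - J) : Set (PBond (F.P K) 0)) ∪ Set.range (iterCentralBond (P := F.P K) (K - J))} → Matrix (Fin 2) (Fin 2) ℂ) b‖ < 1 / 2} := by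
    intro b
    simp only [map_zero, ZeroMemClass.coe_zero, Pi.zero_apply, norm_zero]
    norm_num
  have hUV'o : IsOpen (UV ∩ {y : EuclideanSpace ℝ (Fin dV) | ∀ b : {b : PBond (F.P K) 0 // b ∉ (combSet (K - J) : Set (PBond (F.P K) 0)) ∪ Set.range (iterCentralBond (P := F.P K) (K - J))}, ‖((eV y : (piLogChart (specialUnitaryLogChart (Fin 2)) {b : PBond (F.P K) 0 // b ∉ (combSet (K - J) : Set (PBond (F.P K) 0)) ∪ Set.range (iterCentralBond (P := F.P K) (K - J))}).lie) : {b : PBond (F.P K) 0 // b ∉ (combSet (K - J) : Set (PBond (F.P K) 0)) ∪ Set.range (iterCentralBond (P := F.P K) (K - J))} → Matrix (Fin 2) (Fin 2) ℂ) b‖ < 1 / 2}) := hUVo.inter hSo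
  have hsub : UZ ×ˢ (UV ∩ {y : EuclideanSpace ℝ (Fin dV) | ∀ b : {b : PBond (F.P K) 0 // b ∉ (combSet (K - J) : Set (PBond (F.P K) 0)) ∪ Set.range (iterCentralBond (P := F.P K) (K - J))}, ‖((eV y : (piLogChart (specialUnitaryLogChart (Fin 2)) {b : PBond (F.P K) 0 // b ∉ (combSet (K - J) : Set (PBond (F.P K) 0)) ∪ Set.range (iterCentralBond (P := F.P K) (K - J))}).lie) : {b : PBond (F.P K) 0 // b ∉ (combSet (K - J) : Set (PBond (F.P K) 0)) ∪ Set.range (iterCentralBond (P := F.P K) (K - J))} → Matrix (Fin 2) (Fin 2) ℂ) b‖ < 1 / 2}) ⊆ UZ ×ˢ UV := prod_mono le_rfl inter_subset_left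
  -- the tube map is continuous, hence measurable
  have hΘc : Continuous (fun p : EuclideanSpace ℝ (Fin dZ) × EuclideanSpace ℝ (Fin dV) => pivotAct F hJK (iterCentralBond (P := F.P K) (K - J)) (e p.1) (σ p.2)) :=
    (continuous_pivotAct F hJK (iterCentralBond (P := F.P K) (K - J))).comp₂ (he.comp continuous_fst) (hσ.comp continuous_snd)
  have hΘm : Measurable (fun p : EuclideanSpace ℝ (Fin dZ) × EuclideanSpace ℝ (Fin dV) => pivotAct F hJK (iterCentralBond (P := F.P K) (K - J)) (e p.1) (σ p.2)) := hΘc.measurable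
  -- the image of the smaller window is open ((F3)), hence measurable
  have hAopen : IsOpen ((fun p : EuclideanSpace ℝ (Fin dZ) × EuclideanSpace ℝ (Fin dV) => pivotAct F hJK (iterCentralBond (P := F.P K) (K - J)) (e p.1) (σ p.2)) '' (UZ ×ˢ (UV ∩ {y : EuclideanSpace ℝ (Fin dV) | ∀ b : {b : PBond (F.P K) 0 // b ∉ (combSet (K - J) : Set (PBond (F.P K) 0)) ∪ Set.range (iterCentralBond (P := F.P K) (K - J))}, ‖((eV y : (piLogChart (specialUnitaryLogChart (Fin 2)) {b : PBond (F.P K) 0 // b ∉ (combSet (K - J) : Set (PBond (F.P K) 0)) ∪ Set.range (iterCentralBond (P := F.P K) (K - J))}).lie) : {b : PBond (F.P K) 0 // b ∉ (combSet (K - J) : Set (PBond (F.P K) 0)) ∪ Set.range (iterCentralBond (P := F.P K) (K - J))} → Matrix (Fin 2) (Fin 2) ℂ) b‖ < 1 / 2}))) := by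
    refine isOpen_iff_mem_nhds.2 ?_
    rintro _ ⟨p, hp, rfl⟩
    exact hF3 p (hsub hp) _ ((hUZo.prod hUV'o).mem_nhds hp)
  have hA : MeasurableSet ((fun p : EuclideanSpace ℝ (Fin dZ) × EuclideanSpace ℝ (Fin dV) => pivotAct F hJK (iterCentralBond (P := F.P K) (K - J)) (e p.1) (σ p.2)) '' (UZ ×ˢ (UV ∩ {y : EuclideanSpace ℝ (Fin dV) | ∀ b : {b : PBond (F.P K) 0 // b ∉ (combSet (K - J) : Set (PBond (F.P K) 0)) ∪ Set.range (iterCentralBond (P := F.P K) (K - J))}, ‖((eV y : (piLogChart (specialUnitaryLogChart (Fin 2)) {b : PBond (F.P K) 0 // b ∉ (combSet (K - J) : Set (PBond (F.P K) 0)) ∪ Set.range (iterCentralBond (P := F.P K) (K - J))}).lie) : {b : PBond (F.P K) 0 // b ∉ (combSet (K - J) : Set (PBond (F.P K) 0)) ∪ Set.range (iterCentralBond (P := F.P K) (K - J))} → Matrix (Fin 2) (Fin 2) ℂ) b‖ < 1 / 2}))) := hAopen.measurableSet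
  -- the Haar chart identity restricted to the smaller window
  have hchart' : (fieldMeasure (F.P K) 0 (Matrix.specialUnitaryGroup (Fin 2) ℂ)).restrict ((fun p : EuclideanSpace ℝ (Fin dZ) × EuclideanSpace ℝ (Fin dV) => pivotAct F hJK (iterCentralBond (P := F.P K) (K - J)) (e p.1) (σ p.2)) '' (UZ ×ˢ (UV ∩ {y : EuclideanSpace ℝ (Fin dV) | ∀ b : {b : PBond (F.P K) 0 // b ∉ (combSet (K - J) : Set (PBond (F.P K) 0)) ∪ Set.range (iterCentralBond (P := F.P K) (K - J))}, ‖((eV y : (piLogChart (specialUnitaryLogChart (Fin 2)) {b : PBond (F.P K) 0 // b ∉ (combSet (K - J) : Set (PBond (F.P K) 0)) ∪ Set.range (iterCentralBond (P := F.P K) (K - J))}).lie) : {b : PBond (F.P K) 0 // b ∉ (combSet (K - J) : Set (PBond (F.P K) 0)) ∪ Set.range (iterCentralBond (P := F.P K) (K - J))} → Matrix (Fin 2) (Fin 2) ℂ) b‖ < 1 / 2}))) =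
      ((((volume : Measure (EuclideanSpace ℝ (Fin dZ))).prod (volume : Measure (EuclideanSpace ℝ (Fin dV)))).restrict (UZ ×ˢ (UV ∩ {y : EuclideanSpace ℝ (Fin dV) | ∀ b : {b : PBond (F.P K) 0 // b ∉ (combSet (K - J) : Set (PBond (F.P K) 0)) ∪ Set.range (iterCentralBond (P := F.P K) (K - J))}, ‖((eV y : (piLogChart (specialUnitaryLogChart (Fin 2)) {b : PBond (F.P K) 0 // b ∉ (combSet (K - J) : Set (PBond (F.P K) 0)) ∪ Set.range (iterCentralBond (P := F.P K) (K - J))}).lie) : {b : PBond (F.P K) 0 // b ∉ (combSet (K - J) : Set (PBond (F.P K) 0)) ∪ Set.range (iterCentralBond (P := F.P K) (K - J))} → Matrix (Fin 2) (Fin 2) ℂ) b‖ < 1 / 2}))).withDensity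
          fun w => ENNReal.ofReal (jZ w.1 * jV w.2)).map (fun p : EuclideanSpace ℝ (Fin dZ) × EuclideanSpace ℝ (Fin dV) => pivotAct F hJK (iterCentralBond (P := F.P K) (K - J)) (e p.1) (σ p.2)) := by
    have h1 : (fieldMeasure (F.P K) 0 (Matrix.specialUnitaryGroup (Fin 2) ℂ)).restrict ((fun p : EuclideanSpace ℝ (Fin dZ) × EuclideanSpace ℝ (Fin dV) => pivotAct F hJK (iterCentralBond (P := F.P K) (K - J)) (e p.1) (σ p.2)) '' (UZ ×ˢ (UV ∩ {y : EuclideanSpace ℝ (Fin dV) | ∀ b : {b : PBond (F.P K) 0 // b ∉ (combSet (K - J) : Set (PBond (F.P K) 0)) ∪ Set.range (iterCentralBond (P := F.P K) (K - J))}, ‖((eV y : (piLogChart (specialUnitaryLogChart (Fin 2)) {b : PBond (F.P K) 0 // b ∉ (combSet (K - J) : Set (PBond (F.P K) 0)) ∪ Set.range (iterCentralBond (P := F.P K) (K - J))}).lie) : {b : PBond (F.P K) 0 // b ∉ (combSet (K - J) : Set (PBond (F.P K) 0)) ∪ Set.range (iterCentralBond (P := F.P K) (K - J))} → Matrix (Fin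 2) (Fin 2) ℂ) b‖ < 1 / 2}))) =
        ((fieldMeasure (F.P K) 0 (Matrix.specialUnitaryGroup (Fin 2) ℂ)).restrict ((fun p : EuclideanSpace ℝ (Fin dZ) × EuclideanSpace ℝ (Fin dV) => pivotAct F hJK (iterCentralBond (P := F.P K) (K - J)) (e p.1) (σ p.2)) '' (UZ ×ˢ UV))).restrict ((fun p : EuclideanSpace ℝ (Fin dZ) × EuclideanSpace ℝ (Fin dV) => pivotAct F hJK (iterCentralBond (P := F.P K) (K - J)) (e p.1) (σ p.2)) '' (UZ ×ˢ (UV ∩ {y : EuclideanSpace ℝ (Fin dV) | ∀ b : {b : PBond (F.P K) 0 // b ∉ (combSet (K - J) : Set (PBond (F.P K) 0)) ∪ Set.range (iterCentralBond (P := F.P K) (K - J))}, ‖((eV y : (piLogChart (specialUnitaryLogChart (Fin 2)) {b : PBond (F.P K) 0 // b ∉ (combSet (K - J) : Set (PBond (F.P K) 0)) ∪ Set.range (iterCentralBond (P := F.P K) (K - J))}).lie) : {b : PBond (F.P K) 0 // b ∉ (combSet (K - J) : Set (PBond (F.P K) 0)) ∪ Set.range (iterCentralBond (P := F.P K) (K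 - J))} → Matrix (Fin 2) (Fin 2) ℂ) b‖ < 1 / 2}))) := by
      rw [Measure.restrict_restrict hA, inter_eq_left.2 (image_mono hsub)]
    rw [h1, hchart, Measure.restrict_map hΘm hA, restrict_withDensity (hA.preimage hΘm), Measure.restrict_restrict (hA.preimage hΘm),
      hinj.preimage_image_inter hsub]
  -- positivity of the transversal density on the WHOLE shrunk window: `jV = σ₀·|det jac(eV ·)|` ((F4b′)) and the product-algebra
  -- Jacobian has positive determinant once every free coordinate is shorter than `π` (✓`det_jac_pi_su2_pos`)
  have hjVall : ∀ y ∈ UV ∩ {y : EuclideanSpace ℝ (Fin dV) | ∀ b : {b : PBond (F.P K) 0 // b ∉ (combSet (K - J) : Set (PBond (F.P K) 0)) ∪ Set.range (iterCentralBond (P := F.P K) (K - J))}, ‖((eV y : (piLogChart (specialUnitaryLogChart (Fin 2)) {b : PBond (F.P K) 0 // b ∉ (combSet (K - J) : Set (PBond (F.P K) 0)) ∪ Set.range (iterCentralBond (P := F.P K) (K - J))}).lie) : {b : PBond (F.P K) 0 // b ∉ (combSet (K - J) : Set (PBond (F.P K) 0)) ∪ Set.range (iterCentralBond (P := F.P K)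 (K - J))} → Matrix (Fin 2) (Fin 2) ℂ) b‖ < 1 / 2}, 0 < jV y := by
    obtain ⟨σ₀, hσ₀, hjVeq⟩ := hF4b
    intro y hy
    rw [hjVeq y]
    refine mul_pos hσ₀ (abs_pos.2 (ne_of_gt ?_))
    refine FluctuationComparisonRegPrIntLS2BetaJacPiSinc.det_jac_pi_su2_pos _ (eV y) fun b => ?_
    have hb := hy.2 b
    have hπ : (1 : ℝ) / 2 < Real.pi := by linarith [Real.pi_gt_three]
    exact hb.trans hπ
  refine ⟨e, σ, eV, UZ, UV ∩ {y : EuclideanSpace ℝ (Fin dV) | ∀ b : {b : PBond (F.P K) 0 // b ∉ (combSet (K - J) : Set (PBond (F.P K) 0)) ∪ Set.range (iterCentralBond (P := F.P K) (K - J))}, ‖((eV y : (piLogChart (specialUnitaryLogChart (Fin 2)) {b : PBond (F.P K) 0 // b ∉ (combSet (K - J) : Set (PBond (F.P K) 0)) ∪ Set.range (iterCentralBond (P := F.P K) (K - J))}).lie) : {b : PBond (F.P K) 0 // b ∉ (combSet (K - J) : Set (PBond (F.P K) 0)) ∪ Set.range (iterCentralBond (P := F.P K) (K - J))} → Matrix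 (Fin 2) (Fin 2) ℂ) b‖ < 1 / 2}, jZ, jV, ρ, hσ0, ⟨h0V, h0S⟩, hjVpos, hjVev,
    fun y hy b => hy.2 b, hjVall, hD0, hD1, hF4a, hF4b, he, he1, he𝓝, hσ, hσs, hUZo, hUV'o, h0Z, ?_, hinj.mono hsub,
    fun p hp s hs => hF3 p (hsub hp) s hs, hjZc.continuousOn, hjVc.continuousOn, fun z _ => hjZ0 z, fun y _ => hjV0 y, hchart', hρ, hρUZ, hjZint⟩
  -- (T2-ALL) on the small window
  intro y₁ hy₁
  exact ⟨c₁, hc₁, hT2u y₁ fun b => (hy₁.2 b).le⟩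

end Summit.QuantumFields.YangMills.Theorems.FluctuationComparisonRegPrIntLS2BetaTubeOfRecordFramed

end
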